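import Summits.ABC.ABC.Theorems.PrimePowerRadical.Negative.Orders
import Summits.ABC.ABC.Theorems.PrimePowerRadical.Negative.DoubleWall
import Summits.ABC.ABC.Theorems.PrimePowerRadical.Negative.LinearLoss

/-!
# Line `Sketch` (card `adelic-brjuno-summability`) for the crux `PrimePowerRadical` (stmt-ABC-1648) — lead skeleton

Crux: `Summit.ABC.ABC.Theses.IneffectiveSubspace.PrimePowerRadical` —
`∀ q prime, ∀ ε > 0, ∃ C > 0, ∀ k ≥ 1, q^k < C · rad(1·(q^k−1)·q^k)^{1+ε}`.

Vocabulary (all LANDED, `Summits/ABC/ABC/Theorems/PrimePowerRadical/Negative/*`): `wieferichLevel q p = v_p(q^{2(p−1)} − 1)`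
(`W_p`), `ordMod q p = orderOf (q : ZMod p)` (`d_p`), `oddWieferichExcess q k = ∏_{p odd ∣ q^k−1} p^{W_p − 1}` (`E_W(q,k)`),
and the reformulation `Negative.PPRAt_iff_wieferichSparse` (crux at `q` ⟺ `∀ ε ∃ C ∀ k ≥ 1, E_W(q,k) < C q^{εk}`).
The renormalised `p`-adic Brjuno ATOM of `q` is `c_p := (W_p − 1)·log p / d_p`; `WDC q := Summable (p ↦ c_p)` ("`T_q < ∞`").

Composition (`PrimePowerRadical_of`): `stub_wdc` (T_q < ∞ at every prime base — THE open stub, behind the Wieferich wall: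
WDC q ⟹ crux(q) ⟹ infinitely many non-Wieferich primes base q, `Negative.primePowerRadical_imp_infinite_nonWieferich`)
and `stub_wieferichSparse_of_wdc` (THE LEVER, dominated convergence / M-splitting; proved in `Cruxes/…/SketchIdeator2g2.lean`
against `Cruxes/…/Disproof`, to be ported onto `Negative/*`) give Wieferich sparsity, and `Negative.PPRAt_iff_wieferichSparse`
gives the crux by name. The remaining stubs are the line's unconditional content (each lands `--supports stmt-ABC-1648`):
`stub_romanoff_log` (E[T_q] < ∞ in the 1/p model: `Σ_p log p/(p·d_p) < ∞`, Romanoff 1934 / Erdős–Murty type),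
`stub_atom_tendsto_zero` (NECESSARY direction: crux(q) ⟹ c_p → 0), `stub_excess_littleO` (the dial: `Σ c_p d_p^{1−a} < ∞ ⟹
log E_W(q,k) ≤ ε k^a + C`), `stub_linearLoss_iff_finite_wieferich` (linear loss at `q` ⟺ finitely many Wieferich primes base `q`),
`stub_PPRAt_iff_levelAverage` (crux(q) ⟺ `(1/k)·Σ_{d∣k} E_q(d) → 0`, `E_q(d)` the Wieferich mass charged to the level `d`).
-/

noncomputable section

set_option linter.dupNamespace false

namespace Summit.ABC.ABC.Theorems.PrimePowerRadical.Brjuno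

open Literature.NumberTheory.DiophantineGeometry UniqueFactorizationMonoid
open Summit.ABC.ABC.Theses.IneffectiveSubspace
open Summit.ABC.ABC.Theorems.PrimePowerRadical.Negative
open scoped BigOperators

/-! ## Stubs on the composition path -/

/-- **stub_wdc (OPEN; the lead's stub).** `T_q < ∞`: the renormalised adelic Brjuno sum of the prime `q` converges,
`Σ_p (W_p(q) − 1)·log p / ord_p(q) < ∞`. Behind the Wieferich wall (it implies the crux at `q`, hence infinitely many
non-Wieferich primes to base `q`). -/
theorem stub_wdc (q : ℕ) (hq : q.Prime) :
    Summable (fun p : Nat.Primes =>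
      ((wieferichLevel q p - 1 : ℕ) : ℝ) * Real.log p / (ordMod q p : ℝ)) := by
  sorry

/-- **stub_wieferichSparse_of_wdc (THE LEVER).** `T_q < ∞ ⟹` Wieferich sparsity at `q`:
`∀ ε > 0 ∃ C > 0 ∀ k ≥ 1, E_W(q,k) < C · q^{εk}` (dominated convergence: the Wieferich primes inside `q^k − 1` are those
with `d_p ∣ k`, so `log E_W(q,k) = Σ_{d_p ∣ k} c_p d_p ≤ (k/M)·T_q + k·(tail of T_q over orders > k/M)`). -/
theorem stub_wieferichSparse_of_wdc {q : ℕ} (hq : q.Prime)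
    (h : Summable (fun p : Nat.Primes =>
      ((wieferichLevel q p - 1 : ℕ) : ℝ) * Real.log p / (ordMod q p : ℝ))) :
    ∀ ε : ℝ, 0 < ε → ∃ C : ℝ, 0 < C ∧ ∀ k : ℕ, 1 ≤ k →
      (oddWieferichExcess q k : ℝ) < C * (q : ℝ) ^ (ε * k) := by
  sorry

/-! ## Stubs carrying the line's unconditional content -/

/-- **stub_romanoff_log (Romanoff-type expectation theorem).** For `q ≥ 2`: `Σ_p log p / (p · ord_p(q)) < ∞`
(primes `p ∣ q` contribute `0` since `ordMod q p = 0`). All primes of order `≤ m` divide `∏_{d ≤ m} (q^d − 1) < q^{m²}`,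
so `Σ_{ord_p ≤ m} log p ≤ m² log q`; Abel summation `1/d = Σ_{m ≥ d} 1/(m(m+1))`. -/
theorem stub_romanoff_log {q : ℕ} (hq : 2 ≤ q) :
    Summable (fun p : Nat.Primes => Real.log p / ((p : ℝ) * (ordMod q p : ℝ))) := by
  sorry

/-- **stub_atom_tendsto_zero (NECESSARY direction of the sandwich).** The crux at `q` forces the atoms `c_p → 0`
along the primes (cofinite filter): equivalently, for every `θ > 0` only finitely many primes have
`(W_p − 1) log p ≥ θ · ord_p(q)` ("no giant Wieferich primes"). -/
theorem stub_atom_tendsto_zero {q : ℕ} (hq : q.Prime)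
    (h : ∀ ε : ℝ, 0 < ε → ∃ C : ℝ, 0 < C ∧ ∀ k : ℕ, 1 ≤ k →
      ((q ^ k : ℕ) : ℝ) < C * ((rad 1 (q ^ k - 1) (q ^ k) : ℕ) : ℝ) ^ (1 + ε)) :
    Filter.Tendsto (fun p : Nat.Primes =>
      ((wieferichLevel q p - 1 : ℕ) : ℝ) * Real.log p / (ordMod q p : ℝ)) Filter.cofinite (nhds 0) := by
  sorry

/-- **stub_excess_littleO (the dial).** For `a ≥ 0`: `Σ_p (W_p − 1) log p / ord_p(q)^a < ∞ ⟹
∀ ε > 0 ∃ C ∀ k ≥ 1, log E_W(q,k) ≤ ε k^a + C` (`a = 1` is the lever up to the shape of the constant). -/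
theorem stub_excess_littleO {q : ℕ} (hq : q.Prime) {a : ℝ} (ha : 0 ≤ a)
    (h : Summable (fun p : Nat.Primes =>
      ((wieferichLevel q p - 1 : ℕ) : ℝ) * Real.log p / (ordMod q p : ℝ) ^ a)) :
    ∀ ε : ℝ, 0 < ε → ∃ C : ℝ, ∀ k : ℕ, 1 ≤ k →
      Real.log (oddWieferichExcess q k) ≤ ε * (k : ℝ) ^ a + C := by
  sorry

/-- **stub_linearLoss_iff_finite_wieferich (bottom of the loss dial).** LINEAR loss at the prime base `q`,
`∃ C ∀ k ≥ 1, q^k < C·k·rad(1·(q^k−1)·q^k)`, holds iff `q` has only finitely many Wieferich primes. -/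
theorem stub_linearLoss_iff_finite_wieferich {q : ℕ} (hq : q.Prime) :
    (∃ C : ℝ, ∀ k : ℕ, 1 ≤ k →
        ((q ^ k : ℕ) : ℝ) < C * (k : ℝ) * ((rad 1 (q ^ k - 1) (q ^ k) : ℕ) : ℝ)) ↔
      {p : ℕ | p.Prime ∧ IsWieferich q p}.Finite := by
  sorry

/-- **stub_PPRAt_iff_levelAverage (exact `k`-side reformulation).** The crux at `q` holds iff
`(1/k)·Σ_{d ∣ k} E_q(d) → 0`, where `E_q(d) = Σ_{p odd, p ∣ q^d − 1, ord_p(q) = d} (W_p − 1) log p` is the Wieferich mass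
charged to the cyclotomic level `d` (so `log E_W(q,k) = Σ_{d ∣ k} E_q(d)`). -/
theorem stub_PPRAt_iff_levelAverage {q : ℕ} (hq : q.Prime) :
    (∀ ε : ℝ, 0 < ε → ∃ C : ℝ, 0 < C ∧ ∀ k : ℕ, 1 ≤ k →
      ((q ^ k : ℕ) : ℝ) < C * ((rad 1 (q ^ k - 1) (q ^ k) : ℕ) : ℝ) ^ (1 + ε)) ↔
      Filter.Tendsto (fun k : ℕ => (∑ d ∈ k.divisors,
        ∑ p ∈ ((q ^ d - 1).primeFactors.erase 2).filter (fun p => ordMod q p = d),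
          ((wieferichLevel q p - 1 : ℕ) : ℝ) * Real.log p) / (k : ℝ)) Filter.atTop (nhds 0) := by
  sorry

/-! ## Composition -/

/-- **The line closes the crux modulo its stubs**: `stub_wdc` + `stub_wieferichSparse_of_wdc` give Wieferich sparsity at
every prime base, and `Negative.PPRAt_iff_wieferichSparse` turns sparsity into the crux, concluded BY NAME. -/
theorem PrimePowerRadical_of : PrimePowerRadical := fun q hq =>
  (PPRAt_iff_wieferichSparse hq).mpr (stub_wieferichSparse_of_wdc hq (stub_wdc q hq))

end Summit.ABC.ABC.Theorems.PrimePowerRadical.Brjuno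

end
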